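import Summits.Ventures.AbcSig.Rows.XTemplateBC6
import Summits.Ventures.AbcSig.Rows.XTemplateBC
import Summits.Ventures.AbcSig.Levels.N289
import Summits.Ventures.AbcSig.Rows.XTemplateE3

/-!
# Venture AbcSig — ROW `Xn64Yn17Z2`: `xⁿ + 64 yⁿ = 17 z²` (FAMILY C1b, `α = 6`; GENERATED by p-lean gen3/leanrow_c1b6.py)

E-VARIANT (p-lean g6 `gen6/e3patch.py`; ERRATA E3 form): same statement as `xrow_Xn64Yn17Z2` with ONE more named CITED hypothesis `(hE3 : M.E3Package)` (`Recipes/E3Package.lean`: referee record E3-LEVEL-LEMMA — for `ord₂ B = 6` and `y` even the level-lowered newform sits at the ODD level) and WITHOUT the printed-reading level 578: the sub-class `y` even is sieved at the level 289 like the rows of record do (R3 'Serre level → core (decisive); the 2·core sieve is informational'), so the `DataComplete 578` hypothesis and the uncertified cited survivors of level 578 (citation-backing audit plean/g5/THETAVERIFY-RECORD.md Part C, class INFORMATIONAL-LEVEL) are gone; templates `Rows/XTemplateE3.lean`.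
HONEST FRAMING. A row of a COMPUTATION cell (`pub-abcsig`); a CONDITIONAL theorem, no claim on ABC or any summit.
Hypotheses: `BS04Package` (CITED: [BS04] Lemma 3.3 + (3.1) + Lemma 4.2), `DataComplete` at the levels
289 = 17² (`y` odd, case (v₆)) and 578 = 2·17² (`y` even, case (v₇)) (COMPUTED, certified level files), `Refines…` of
kernel module certificates (COMPUTED) if any, and the listed per-orbit exclusions `hX_…` (CITED; the row of record's R3/R5
name the module / printed argument per orbit: M4 Kraus certificates, M6c, [BS04, Prop. 4.4 / 4.6]). Everything else is
kernel-checked (`Rows/XTemplateBC6.lean`, `Rows/XTemplateBC.lean`, `Levels/N….lean`).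
Exponent range: prime `n ≥ 7`, n ∉ [17]; `x·y ≠ ±1`.
Row of record: `census/rows/C1b/C1b-C17-a6.md` (sha16 `3abc7a50871df606`; R8-signed by referee ref-g20, 2026-08-22T23:18Z); p1's statement of record: the conjunct `Rows.C1bCell 17 (fun _ α => α = 6) 7 ∅` of `Rows.C1bSmallAlphaSigned` (`Rows/StatementsC1b.lean`). Level 289 = 17² generated on the hub from the census level file (engine-1 Sturm file). Residual exponents of OUR kernel sieve that the row closes by a module (M4 Kraus — family-specific —, M6 / M6c, [BS04, Prop. 4.4 / 4.6]) enter as the named hypotheses `hX_… : n ∈ [...] → M.Excludes …` (CITED), as do rational orbits not eliminable by the sieve (all n).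
-/

namespace Summit.Ventures.AbcSig

/-- Row `Xn64Yn17Z2`: no primitive solution of `xⁿ + 64 yⁿ = 17 z²` with `x·y ≠ ±1` for prime `n ≥ 7`, `n ∉ [17]`,
conditional on the named hypotheses. -/
theorem xrow_Xn64Yn17Z2XE (M : NewformModel) (hP : M.BS04Package) (hE3 : M.E3Package)
    (hD289 : M.DataComplete 289 level289Orbits)
    (n : ℕ) (hn : n.Prime) (hmin : 7 ≤ n) (hres : n ∉ ([17] : List ℕ))
    (hX_orbit_289_1 : M.Excludes 289 orbit_289_1
      (famBC 6 17 n (fun _ b => ¬ 2 ∣ b)))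
    (hX_orbit_289_1e : M.Excludes 289 orbit_289_1
      (famBC 6 17 n (fun _ b => 2 ∣ b)))
    (x y z : ℤ) (hxy1 : x * y ≠ 1) (hxy2 : x * y ≠ -1) : ¬ IsPrimitiveSolution 1 (2 ^ 6) 17 n x y z := by
  have h7 : 7 ≤ n := by omega
  have hC : Nat.Prime 17 := by norm_num
  have hsq : Squarefree (17 : ℕ) := (Nat.prime_iff.mp hC).squarefree
  have hnC : ¬ n ∣ 17 := by
    intro h
    simp only [List.mem_cons, List.not_mem_nil, or_false] at hres; rcases (Nat.dvd_prime hC).mp h with h1 | h1 <;> omega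
  by_cases hy : 2 ∣ y
  · exact xbranchBC_v7E3 17 hsq (by decide) M hP hE3 hD289 n hn h7 hnC
      (level289_sieve n hn h7 (fun o => M.Excludes 289 o
      (famBC 6 17 n (fun _ b => 2 ∣ b)) ∨ M.ExcludesStd 289 o n) (Or.inl hX_orbit_289_1e))
      x y z hy hxy1 hxy2
  · exact xbranchBC_v6 17 hsq (by decide) M hP hD289 n hn h7 hnC
      (level289_sieve n hn h7 (fun o => M.Excludes 289 o
      (famBC 6 17 n (fun _ b => ¬ 2 ∣ b)) ∨ M.ExcludesStd 289 o n) (Or.inl hX_orbit_289_1))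
      x y z hy hxy1 hxy2

end Summit.Ventures.AbcSig
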